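import Literature.AlgebraicGeometry.HodgeTheory.ComplexGysin
import Literature.AlgebraicGeometry.HodgeTheory.TopDegreeClasses
import Literature.AlgebraicTopology.SingularHomology.GysinMapOrientationChange
import HarnessLib

/-!
# The Gysin morphisms `complexGysin μ` depend on the orientation family `μ` only up to non-zero
# scalars

Companion to `ComplexGysin` (the Gysin morphism
`complexGysin μ hY hX f : Hᵃ(Y(ℂ); ℂ) → Hᵇ(X(ℂ); ℂ)` of a morphism `f : Y ⟶ X` of smooth projective
complex varieties, `a + 2 dim X = b + 2 dim Y`, relative to a family `μ` of `ℂ`-orientations of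
the closed manifolds `X(ℂ)`: Fulton, *Young Tableaux*, App. B §B.1 (5), `f_* = PD⁻¹ ∘ f(ℂ)_* ∘ PD`).
The intended `μ` is the family of complex orientations, but consumers quantify over all `μ` with
Poincaré duality (e.g. the named facts of `GysinKernel` and `GysinHodgeClassLift`). This file
PROVES that this freedom is harmless: since `X(ℂ)` is CONNECTED for `X` smooth projective
(geometrically irreducible; SGA1 XII Prop. 2.4, the tree's `connectedSpace_complexPoints`), two
`ℂ`-orientations of `X(ℂ)` have proportional fundamental classes (Hatcher, Thm. 3.26(b);
`HomologicalOrientation.exists_unit_fundamentalClass_eq_smul`), so that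

* `OrientationFamily.exists_fundamentalClass_eq_smul`: `[X(ℂ)]_{μ'} = u • [X(ℂ)]_μ`, `u ≠ 0`;
* `complexGysin_eq_smul_of_orientationFamily`: `complexGysin μ' … f = c • complexGysin μ … f` for a
  scalar `c ≠ 0` (`c = u_X⁻¹ u_Y`; `gysinMap_eq_smul_of_fundamentalClass_eq`);
* `range_complexGysin_eq_of_orientationFamily`, `map_complexGysin_eq_of_orientationFamily`: the
  image of `complexGysin μ … f`, and the image under it of any `ℂ`-subspace, do not depend on `μ`.

Hence statements about images of Gysin morphisms of complex subspaces (Deligne's Cor. 8.2.8,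
Voisin's Cor. 2.12 on the tree's carriers) hold for every orientation family with Poincaré
duality as soon as they hold for one (`GysinHodgeClassLiftProofs`).

## References

* [FultonYoungTableaux1997] W. Fulton, Young Tableaux, CUP 1997, App. B §B.1 (4)–(5).
* [HatcherAT2002] A. Hatcher, Algebraic Topology, CUP 2002, §3.3 Thm. 3.26, Thm. 3.30.
* [SGA1] A. Grothendieck, M. Raynaud, SGA 1, Exp. XII Prop. 2.4.
-/

noncomputable section

open CategoryTheory AlgebraicGeometry
open Literature.AlgebraicTopology.SingularHomology

namespace Literature.AlgebraicGeometry.HodgeTheory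

section HodgeTheory

variable {μ μ' : OrientationFamily} {m n : ℕ} {Y X : Motives.SchemeOver ℂ}

/-- **Two `ℂ`-orientations of `X(ℂ)`, `X` smooth projective, have proportional fundamental
classes**: `[X(ℂ)]_{μ'} = u • [X(ℂ)]_μ` with `u ≠ 0` — `X(ℂ)` is a closed connected
`2n`-manifold (GAGA charts; compact, Hausdorff; connected by SGA1 XII Prop. 2.4) and two
orientations of a closed connected manifold differ by a unit (Hatcher, Thm. 3.26).
[cite: HatcherAT2002, §3.3 Thm. 3.26] [cite: SGA1, Exp. XII Prop. 2.4] -/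
theorem OrientationFamily.exists_fundamentalClass_eq_smul (μ μ' : OrientationFamily)
    (hX : Motives.IsSmoothProjective n X) :
    ∃ u : ℂ, u ≠ 0 ∧ (μ' hX).fundamentalClass = u • (μ hX).fundamentalClass := by
  letI := hX.chartedSpace
  haveI := Motives.ComplexPoints.compactSpace_of_isSmoothProjective hX
  haveI := Motives.ComplexPoints.t2Space_of_isSmoothProjective hX
  haveI := connectedSpace_complexPoints hX
  obtain ⟨u, hu, -⟩ := (μ hX).exists_unit_fundamentalClass_eq_smul (μ' hX)
  exact ⟨u, u.ne_zero, hu⟩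

/-- **`complexGysin μ' = c • complexGysin μ`, `c ≠ 0`**, for any two orientation families with
Poincaré duality and every morphism `f : Y ⟶ X` of smooth projective varieties (in degrees
`a ≤ 2 dim Y`: `gysinMap_eq_smul_of_fundamentalClass_eq` with `c = u_X⁻¹ u_Y`, where
`[Y(ℂ)]_{μ'} = u_Y • [Y(ℂ)]_μ`, `[X(ℂ)]_{μ'} = u_X • [X(ℂ)]_μ`; in degrees `a > 2 dim Y` both sides
vanish). [cite: FultonYoungTableaux1997, Appendix B §B.1 (5)] [cite: HatcherAT2002, §3.3 Thm. 3.26] -/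
theorem complexGysin_eq_smul_of_orientationFamily (hμ : μ.HasPoincareDuality)
    (hμ' : μ'.HasPoincareDuality) (hY : Motives.IsSmoothProjective m Y)
    (hX : Motives.IsSmoothProjective n X) (f : Y ⟶ X) {a b : ℕ} (hab : a + 2 * n = b + 2 * m) :
    ∃ c : ℂ, c ≠ 0 ∧ complexGysin μ' hY hX f hab = c • complexGysin μ hY hX f hab := by
  obtain ⟨uY, huY, hY'⟩ := μ.exists_fundamentalClass_eq_smul μ' hY
  obtain ⟨uX, huX, hX'⟩ := μ.exists_fundamentalClass_eq_smul μ' hX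
  refine ⟨uX⁻¹ * uY, mul_ne_zero (inv_ne_zero huX) huY, ?_⟩
  by_cases h : a ≤ 2 * m
  · rw [complexGysin_eq_gysinMap hY hX f hab (q := 2 * m - a) (by omega) (by omega),
      complexGysin_eq_gysinMap hY hX f hab (q := 2 * m - a) (by omega) (by omega)]
    exact gysinMap_eq_smul_of_fundamentalClass_eq (hμ hX) (hμ' hX) hY' hX'
      (by rw [← mul_assoc, mul_inv_cancel₀ huX, one_mul]) _ _ _
  · rw [complexGysin_of_lt hY hX f hab (not_le.1 h), complexGysin_of_lt hY hX f hab (not_le.1 h),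
      smul_zero]

/-- **The image of a Gysin morphism does not depend on the orientation family.**
[cite: FultonYoungTableaux1997, Appendix B §B.1 (5)] -/
theorem range_complexGysin_eq_of_orientationFamily (hμ : μ.HasPoincareDuality)
    (hμ' : μ'.HasPoincareDuality) (hY : Motives.IsSmoothProjective m Y)
    (hX : Motives.IsSmoothProjective n X) (f : Y ⟶ X) {a b : ℕ} (hab : a + 2 * n = b + 2 * m) :
    LinearMap.range (complexGysin μ' hY hX f hab) = LinearMap.range (complexGysin μ hY hX f hab) := by
  obtain ⟨c, hc, h⟩ := complexGysin_eq_smul_of_orientationFamily hμ hμ' hY hX f hab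
  rw [h]
  exact LinearMap.range_smul _ _ hc

/-- **The image of a `ℂ`-subspace under a Gysin morphism does not depend on the orientation
family.** [cite: FultonYoungTableaux1997, Appendix B §B.1 (5)] -/
theorem map_complexGysin_eq_of_orientationFamily (hμ : μ.HasPoincareDuality)
    (hμ' : μ'.HasPoincareDuality) (hY : Motives.IsSmoothProjective m Y)
    (hX : Motives.IsSmoothProjective n X) (f : Y ⟶ X) {a b : ℕ} (hab : a + 2 * n = b + 2 * m)
    (S : Submodule ℂ (complexBetti Y a)) :
    S.map (complexGysin μ' hY hX f hab) = S.map (complexGysin μ hY hX f hab) := by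
  obtain ⟨c, hc, h⟩ := complexGysin_eq_smul_of_orientationFamily hμ hμ' hY hX f hab
  rw [h]
  exact Submodule.map_smul _ _ _ hc

end HodgeTheory

end Literature.AlgebraicGeometry.HodgeTheory

end
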